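import Summits.BirchSwinnertonDyer.BirchSwinnertonDyer.Theorems.AlignedTransportAtTwoMainConjectureOfRankZeroBSDAtTwoResolventMuUnconditional
import Literature.NumberTheory.IwasawaTheory.ClassicalMuInvariantOnePrimeProofs
import HarnessLib

/-!
# Route `AlignedTransportAtTwo`, crux C2 `MainConjectureOfRankZeroBSDAtTwo` (stmt-BirchSwinnertonDyer-22298):
# IWASAWA'S CRITERION ON THE RESOLVENT — `2 ∤ h(ℚ(√Δ_W))` and ONE prime of `ℚ(√Δ_W)` above `2` ⟹ `λ₂(ℚ(√Δ_W)) = 0`, hence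
# `λ₂(ℚ(W[2])) = 2·λ₂(ℚ(β))` by the sign-free Kuroda identity (both signs; the `Δ_W > 0` use case)

Sequel of `…ResolventMuUnconditional` (same seat `bsd-line-att-p3` g34). HONEST FRAMING: WIDTH-5 attached prover seat on line `birth` of the lead `bsd-line-att-p2`;
`--supports` stmt-BirchSwinnertonDyer-22298, closes nothing; BSD is NOT proved; crux C2, its verdict «blocked-on `Rank1Residual.GreenbergMuConjectureIrreducible`»
and every registered stub untouched. THEOREMS ONLY; the two displayed hypotheses on the resolvent are per-curve CHECKABLE data (class number parity, the
prime `2` not split: for `ℚ(√d)` with `d ∉ 1 + 8ℤ`), nothing is computed here.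

* `classNumberPExp_resolvent_eq_zero_of_odd_classNumber_of_unique_prime` — `2 ∤ h(ℚ(4δ₀))` and exactly one prime of `𝓞 ℚ(4δ₀)` containing `2` ⟹ `e_n = 0`
  for every `n` and every `ℤ₂`-extension of the resolvent model (Iwasawa 1956, tree theorem `…_holds`); `classicalLambda_resolvent_eq_zero_…` (`λ₂ = 0`).
* ★ `classicalLambda_divisionField_two_eq_two_mul_cubic_of_odd_classNumber_of_unique_prime` — with `W(ℚ)[2] = 0`, `Δ_W, 2Δ_W ∉ ℚ²` and `μ₂ = 0` on ONE cubic
  tower: **`λ₂(ℚ(W[2])) = 2·λ₂(ℚ(β_j))`** (any cyclotomic towers) — the sign-free identity of `…ResolventMuUnconditional` with the resolvent term killed.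
  On `Δ_W > 0` this is the expected generic situation (Greenberg); on `Δ_W < 0` it is the case `Σ(d) = 1` of Ferrero–Kida.
* `…_of_isOrdinaryAt` — on C2's binders.

References: [Iwasawa1956]; [Greenberg2001IwasawaPastPresent] Prop. 2.1; [Washington1997] Prop. 13.22; [Greenberg1976TotallyReal] §1; [OzakiTaya1997] §1; tree:
`ClassicalMuInvariantOnePrimeProofs` (Iwasawa 1956 `_holds`), `…ResolventMuUnconditional`.
-/

set_option linter.dupNamespace false
set_option autoImplicit false

noncomputable section

open scoped Classical NumberField

namespace Summit.BirchSwinnertonDyer.BirchSwinnertonDyer.Theorems.AlignedTransportAtTwoResolventIwasawaCriterionLambda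

open NumberField Polynomial WeierstrassCurve IntermediateField Field IsDedekindDomain
  Literature.NumberTheory.EllipticCurves Literature.NumberTheory.EllipticCurves.Greenberg1999
  Literature.NumberTheory.EllipticCurves.DokchitserDokchitser2012
  Literature.NumberTheory.EllipticCurves.ZpExtension Literature.NumberTheory.GaloisRepresentations
  Literature.NumberTheory.IwasawaTheory Literature.NumberTheory.NumberFields
  Summit.BirchSwinnertonDyer.BirchSwinnertonDyer.Theorems.AlignedTransportAtTwoFineRoad.DivisionCubic
  Summit.BirchSwinnertonDyer.BirchSwinnertonDyer.Theorems.AlignedTransportAtTwoFineRoad.TowerImageDelta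
  Summit.BirchSwinnertonDyer.BirchSwinnertonDyer.Theorems.AlignedTransportAtTwoSexticNormRelationDescent
  Summit.BirchSwinnertonDyer.BirchSwinnertonDyer.Theorems.AlignedTransportAtTwoSexticNormRelationDescentSignFree
  Summit.BirchSwinnertonDyer.BirchSwinnertonDyer.Theorems.AlignedTransportAtTwoResolventMuUnconditional

variable (W : WeierstrassCurve ℚ) [W.IsElliptic]

/-! ## §1 Iwasawa's criterion on the resolvent model `ℚ(4δ₀)` -/

/-- **`e_n(ℚ(√Δ_W)) = 0` for every `n` and EVERY `ℤ₂`-extension of the resolvent model** when `2 ∤ h(ℚ(4δ₀))` and exactly one prime of `𝓞 ℚ(4δ₀)` contains `2`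
(Iwasawa 1956: the tree theorem `iwasawa1956_classNumberPExp_eq_zero_of_not_dvd_classNumber_of_unique_prime_holds`). [cite: Greenberg2001IwasawaPastPresent, Prop. 2.1 p. 339]
[cite: Washington1997, Prop. 13.22] -/
theorem classNumberPExp_resolvent_eq_zero_of_odd_classNumber_of_unique_prime
    [NumberField ↥ℚ⟮4 * delta W two_ne_zero⟯] (hh : ¬ 2 ∣ classNumber ↥ℚ⟮4 * delta W two_ne_zero⟯)
    (hv : ∃! v : HeightOneSpectrum (𝓞 ↥ℚ⟮4 * delta W two_ne_zero⟯), ((2 : ℕ) : 𝓞 ↥ℚ⟮4 * delta W two_ne_zero⟯) ∈ v.asIdeal)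
    (κK : ZpExtension ↥ℚ⟮4 * delta W two_ne_zero⟯ 2) (n : ℕ) : classNumberPExp κK n = 0 :=
  haveI : Fact (Nat.Prime 2) := ⟨Nat.prime_two⟩
  iwasawa1956_classNumberPExp_eq_zero_of_not_dvd_classNumber_of_unique_prime_holds _ 2 hh hv κK n

/-- Hence **`λ₂(ℚ(√Δ_W)) = 0`** (and `μ₂ = 0`) for every `ℤ₂`-extension of the resolvent model under Iwasawa's criterion. [cite: Greenberg2001IwasawaPastPresent, Prop. 2.1 p. 339] -/
theorem classicalLambda_resolvent_eq_zero_of_odd_classNumber_of_unique_prime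
    [NumberField ↥ℚ⟮4 * delta W two_ne_zero⟯] (hh : ¬ 2 ∣ classNumber ↥ℚ⟮4 * delta W two_ne_zero⟯)
    (hv : ∃! v : HeightOneSpectrum (𝓞 ↥ℚ⟮4 * delta W two_ne_zero⟯), ((2 : ℕ) : 𝓞 ↥ℚ⟮4 * delta W two_ne_zero⟯) ∈ v.asIdeal)
    (κK : ZpExtension ↥ℚ⟮4 * delta W two_ne_zero⟯ 2) : classicalLambda κK = 0 :=
  haveI : Fact (Nat.Prime 2) := ⟨Nat.prime_two⟩
  classicalLambda_eq_zero_of_eventually_const κK (c := 0) (n₀ := 0)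
    fun n _ ↦ classNumberPExp_resolvent_eq_zero_of_odd_classNumber_of_unique_prime W hh hv κK n

/-! ## §2 The sextic `λ₂` is twice the cubic `λ₂` -/

/-- ★ **`λ₂(ℚ(W[2])) = 2·λ₂(ℚ(β_j))` under Iwasawa's criterion on the resolvent.** `W/ℚ` elliptic, no rational `2`-torsion abscissa, `Δ_W, 2Δ_W ∉ ℚ²` (both
signs), `2 ∤ h(ℚ(4δ₀))`, exactly one prime of `𝓞 ℚ(4δ₀)` above `2`, and `μ₂ = 0` along the cyclotomic `ℤ₂`-tower of ONE cubic field `ℚ(β_i)`: then for any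
cyclotomic `κT` of `ℚ(W[2])` and `κk` of `ℚ(β_j)`, `classicalLambda κT = 2 · classicalLambda κk` (the sign-free `S₃` Kuroda identity with `λ₂(resolvent) = 0`).
[cite: Greenberg2001IwasawaPastPresent, Prop. 2.1 p. 339] [cite: Iwasawa1973MuInvariants, Thm. 2 and Thm. 3, §3] [cite: Bartel2012, Thm. 1.2] -/
theorem classicalLambda_divisionField_two_eq_two_mul_cubic_of_odd_classNumber_of_unique_prime (ht : ∀ x : ℚ, ¬ HasRationalTwoTorsionX W x)
    (hsq : ¬ IsSquare W.Δ) (h2Δ : ¬ IsSquare (2 * W.Δ))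
    [NumberField ↥ℚ⟮4 * delta W two_ne_zero⟯] (hh : ¬ 2 ∣ classNumber ↥ℚ⟮4 * delta W two_ne_zero⟯)
    (hv : ∃! v : HeightOneSpectrum (𝓞 ↥ℚ⟮4 * delta W two_ne_zero⟯), ((2 : ℕ) : 𝓞 ↥ℚ⟮4 * delta W two_ne_zero⟯) ∈ v.asIdeal)
    (i : Fin 3) (hμi : ∀ κi : ZpExtension ↥ℚ⟮xT W two_ne_zero i⟯ 2, κi.IsCyclotomic → ClassicalMuVanishes κi)
    (j : Fin 3) (κT : ZpExtension (W.divisionField 2) 2) (hκT : κT.IsCyclotomic)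
    (κk : ZpExtension ↥ℚ⟮xT W two_ne_zero j⟯ 2) (hκk : κk.IsCyclotomic) :
    classicalLambda κT = 2 * classicalLambda κk := by
  haveI : Fact (Nat.Prime 2) := ⟨Nat.prime_two⟩
  obtain ⟨κK, hκK⟩ := exists_cyclotomicZpExtension_holds ↥ℚ⟮4 * delta W two_ne_zero⟯ 2
  have h := classicalLambda_divisionField_two_eq_resolvent_add_two_mul_cubic_of_not_isSquare W ht hsq h2Δ i hμi j κT hκT κK hκK κk hκk
  rw [classicalLambda_resolvent_eq_zero_of_odd_classNumber_of_unique_prime W hh hv κK, zero_add] at h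
  exact h

/-- **On C2's binders** (`W` globally minimal, good ordinary at `2`, no rational `2`-torsion abscissa, `Δ_W ∉ ℚ²`; `2Δ_W ∉ ℚ²` automatic): Iwasawa's criterion on
`ℚ(√Δ_W)` and `μ₂ = 0` on one cubic tower give `λ₂(ℚ(W[2])) = 2·λ₂(ℚ(β_j))`. [cite: Greenberg2001IwasawaPastPresent, Prop. 2.1 p. 339] [cite: SilvermanAEC2009, VII.5 Prop. 5.1(a)] -/
theorem classicalLambda_divisionField_two_eq_two_mul_cubic_of_isOrdinaryAt [W.IsGloballyMinimal] (hord : IsOrdinaryAt W 2)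
    (ht : ∀ x : ℚ, ¬ HasRationalTwoTorsionX W x) (hsq : ¬ IsSquare W.Δ)
    [NumberField ↥ℚ⟮4 * delta W two_ne_zero⟯] (hh : ¬ 2 ∣ classNumber ↥ℚ⟮4 * delta W two_ne_zero⟯)
    (hv : ∃! v : HeightOneSpectrum (𝓞 ↥ℚ⟮4 * delta W two_ne_zero⟯), ((2 : ℕ) : 𝓞 ↥ℚ⟮4 * delta W two_ne_zero⟯) ∈ v.asIdeal)
    (i : Fin 3) (hμi : ∀ κi : ZpExtension ↥ℚ⟮xT W two_ne_zero i⟯ 2, κi.IsCyclotomic → ClassicalMuVanishes κi)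
    (j : Fin 3) (κT : ZpExtension (W.divisionField 2) 2) (hκT : κT.IsCyclotomic)
    (κk : ZpExtension ↥ℚ⟮xT W two_ne_zero j⟯ 2) (hκk : κk.IsCyclotomic) :
    classicalLambda κT = 2 * classicalLambda κk :=
  classicalLambda_divisionField_two_eq_two_mul_cubic_of_odd_classNumber_of_unique_prime W ht hsq (not_isSquare_two_mul_Δ_of_isOrdinaryAt W hord)
    hh hv i hμi j κT hκT κk hκk

end Summit.BirchSwinnertonDyer.BirchSwinnertonDyer.Theorems.AlignedTransportAtTwoResolventIwasawaCriterionLambda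

end
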